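import Mathlib
import Literature.Analysis.OperatorTheory.ContractiveDetComplexity
import Summits.ValiantsHypothesis.ValiantsHypothesis.Theorems.ContractivityPricePriceOfContractivityStubFewColoursSchur
import Summits.ValiantsHypothesis.ValiantsHypothesis.Theorems.ContractivityPricePriceOfContractivityStubFewColoursCoeffBound
import HarnessLib

/-!
# ♦ for few colour classes — piece (W6a) `piece3_contentBounds`: content regrouping of the
# Schur expansion, with all coefficient bounds

Crux `PriceOfContractivity` (stmt-ValiantsHypothesis-10583), line `registered` (birth rev 11),
registered partial case `stub_stableLifting_fewColours` (Theorem A″, few colour classes), piece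
`piece3_contentBounds` (W6a = steps (W2) + (W3) of Lines/birth-fewcolours.md §1, packaged for the
final assembly).

**Statement.** Let `K = [[A, B], [C, D]]` on `Fin n ⊕ Fin t` be coloured `x` on the first block
and `c = g ∘ idx` on the second, `g : Fin f → σ` an injective enumeration of foreign colours, all
`≠ x`, and let the pencil determinant `P = det (1 + diag (X ∘ κ) K)` have no zero on the closed
polydisc of radius `2`.  Then `P = â + Σ_{β ≠ 0} p̂_β · ∏_j X_{g j}^{β j}` over the box
`β : Fin f → Fin (t+1)`, where `a = det (1 + ξA)` (`a(0) = 1`, `deg a ≤ n`,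
`|a_m| ≤ 3 ((n+1)/2)^m`), `deg p_β ≤ n + t` and `|p_{β,m}| ≤ 9 (t/2)^{|β|} ((n+1)/2)^m`
(`^` = substitution `ξ ↦ X_x`).

**Proof.** (1) By the Schur expansion (landed W2, `piece3_schurExpansion`)
`P = Σ_{S ⊆ Fin t} Ê_S ∏_{i ∈ S} X_{c i}` with the bordered determinants `E_S ∈ ℂ[ξ]`,
`deg E_S ≤ n + |S|`, `E_∅ = a`.  (2) Regroup by the colour content
`cont S = (#{i ∈ S : idx i = j})_j`: `∏_{i ∈ S} X_{c i} = ∏_j X_{g j}^{cont S j}`, `cont S = 0` iff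
`S = ∅`, and `p_β := Σ_{cont S = β} E_S`.  (3) At `z = ξ e_x` (`|ξ| ≤ 2`) only `S = ∅` survives,
so `a(ξ) ≠ 0`.  (4) `a(ξ) = ∏ (1 + λᵢ ξ)` with `|λᵢ| ≤ 1/2` (landed eigenvalue lemmas), whence
`|a(ξ)| ≤ (1 + 1/(n+1))^(n+1) ≤ 3` for `|ξ| ≤ 2/(n+1)` and `|a_m| ≤ 3 ((n+1)/2)^m` by Cauchy's
estimate (landed `piece_c_cauchy`).  (5) For fixed `|ξ| ≤ 2` the polynomial
`q̂ = Σ_S (E_S(ξ)/a(ξ)) ∏_{i ∈ S} X_{idx i}` in the variables `Fin f` has total degree `≤ t`,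
`q̂(0) = 1`, no zero on the closed radius-2 polydisc (its value at `ẑ` is `P(z)/a(ξ)` for the
point `z = (ξ at x, ẑ ∘ g⁻¹)`), and coefficient `p_β(ξ)/a(ξ)` at `β`; the landed coefficient bound
(W3, `piece3_coeffBound`) gives `|p_β(ξ)| ≤ 3 (t/2)^{|β|} |a(ξ)|`.  (6) Hence
`|p_β| ≤ 9 (t/2)^{|β|}` on `|ξ| ≤ 2/(n+1)` and Cauchy's estimate finishes.  All folklore; no
definitions.
-/

noncomputable section

-- `Summit.<Summit>.<Problem>` repeats `ValiantsHypothesis` by the tree's layout convention (D-0017).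
set_option linter.dupNamespace false

namespace Summit.ValiantsHypothesis.ValiantsHypothesis.Theorems.PriceOfContractivity.FewColours

open Matrix
open Summit.ValiantsHypothesis.ValiantsHypothesis.Theorems.PriceOfContractivity.OneLargeClass
  (schur_eval_det_one_add_X_smul schur_eval_aeval_X piece_c_cauchy bnd_norm_update_le)
open Summit.ValiantsHypothesis.ValiantsHypothesis.Theorems.PriceOfContractivity.MonochromeBlocks
  (exists_det_one_add_smul_eq_prod norm_le_half_of_prod_ne_zero)

/-! ### Helpers -/

/-- Regrouping a product over `S` by the fibres of an index map: `∏_{i ∈ S} h (idx i) =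
∏_j (h j) ^ #{i ∈ S : idx i = j}`. [folklore] -/
theorem prod_comp_eq_prod_pow_card_fiber {M : Type*} [CommMonoid M] {t f : ℕ}
    (idx : Fin t → Fin f) (S : Finset (Fin t)) (h : Fin f → M) :
    ∏ i ∈ S, h (idx i) = ∏ j, h j ^ (S.filter fun i => idx i = j).card := by
  rw [← Finset.prod_fiberwise' S idx h]
  exact Finset.prod_congr rfl fun j _ => Finset.prod_const _

/-- A block matrix whose second block row is indexed by an empty type has the determinant of its
first diagonal block. [folklore] -/
theorem det_fromBlocks_of_isEmpty_right {R : Type*} [CommRing R] {m o : Type*} [Fintype m]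
    [DecidableEq m] [Fintype o] [DecidableEq o] [IsEmpty o] (A' : Matrix m m R) (B' : Matrix m o R)
    (C' : Matrix o m R) (D' : Matrix o o R) : (Matrix.fromBlocks A' B' C' D').det = A'.det := by
  rw [Subsingleton.elim C' 0, Matrix.det_fromBlocks_zero₂₁, Matrix.det_isEmpty (A := D'), mul_one]

/-- `deg E_w ≤ n + |o|` for the bordered determinant `E_w = det [[1 + ξA, ξB_w], [C_w, D_ww]]`
indexed by a map `w : o → Fin t` from a finite type (affine entries).
[folklore; adapted from `OneLargeClass.natDegree_bordPoly_le`] -/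
theorem natDegree_bordPoly_le_card {n t : ℕ} {o : Type*} [Fintype o] [DecidableEq o]
    (A : Matrix (Fin n) (Fin n) ℂ) (B : Matrix (Fin n) (Fin t) ℂ) (C : Matrix (Fin t) (Fin n) ℂ)
    (D : Matrix (Fin t) (Fin t) ℂ) (w : o → Fin t) :
    (Matrix.fromBlocks
        ((1 : Matrix (Fin n) (Fin n) (Polynomial ℂ)) +
          (Polynomial.X : Polynomial ℂ) • A.map (fun a : ℂ => Polynomial.C a))
        ((Polynomial.X : Polynomial ℂ) • (B.submatrix id w).map (fun a : ℂ => Polynomial.C a))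
        ((C.submatrix w id).map (fun a : ℂ => Polynomial.C a))
        ((D.submatrix w w).map (fun a : ℂ => Polynomial.C a))).det.natDegree ≤
      n + Fintype.card o := by
  have h := Polynomial.natDegree_det_X_add_C_le
    (Matrix.fromBlocks A (B.submatrix id w) 0 0)
    (Matrix.fromBlocks 1 0 (C.submatrix w id) (D.submatrix w w))
  have hmat : (Polynomial.X : Polynomial ℂ) •
        (Matrix.fromBlocks A (B.submatrix id w) 0 0).map Polynomial.C +
      (Matrix.fromBlocks 1 0 (C.submatrix w id) (D.submatrix w w)).map Polynomial.C =
      Matrix.fromBlocks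
        ((1 : Matrix (Fin n) (Fin n) (Polynomial ℂ)) +
          (Polynomial.X : Polynomial ℂ) • A.map (fun a : ℂ => Polynomial.C a))
        ((Polynomial.X : Polynomial ℂ) • (B.submatrix id w).map (fun a : ℂ => Polynomial.C a))
        ((C.submatrix w id).map (fun a : ℂ => Polynomial.C a))
        ((D.submatrix w w).map (fun a : ℂ => Polynomial.C a)) := by
    rw [Matrix.fromBlocks_map, Matrix.fromBlocks_map, Matrix.fromBlocks_smul, Matrix.fromBlocks_add]
    simp [Matrix.map_one Polynomial.C (map_zero _) (map_one _), add_comm]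
  rw [hmat] at h
  simpa using h

/-! ### The piece -/

/-- **Piece W6a: the coefficient family of the content regrouping, with all bounds.**  For the
two-block pencil of `[[A,B],[C,D]]` (colour `x` on `Fin n`, `c` on `Fin t`, `c` factoring through
an injective enumeration `g : Fin f → σ` of foreign colours, all `≠ x`) whose determinant `P` is
zero-free on the closed radius-2 polydisc: `P = â + Σ_{β ≠ 0} p̂_β · ∏_j X_{g j}^{β j}` over the
box `β : Fin f → Fin (t+1)`, with `a = det (1 + ξA)` (`a(0) = 1`, `deg ≤ n`,
`|a_m| ≤ 3 ((n+1)/2)^m`) and `p_β = Σ_{content S = β} E_S` (`deg ≤ n + t`,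
`|p_{β,m}| ≤ 9 (t/2)^{|β|} ((n+1)/2)^m`) — the Schur expansion regrouped by content, the
coefficient bound applied to `P(ξ,·)/a(ξ)` (total degree `≤ t`, zero-free, value `1` at `0`),
`|a| ≤ 3` on `|ξ| ≤ 2/(n+1)` (eigenvalues `≤ 1/2`), and Cauchy's estimate on that disc.
[folklore] -/
theorem piece3_contentBounds :
    ∀ {σ : Type} (x : σ) {n t f : ℕ} (c : Fin t → σ) (g : Fin f → σ) (idx : Fin t → Fin f),
      (∀ i, g (idx i) = c i) → (∀ j, g j ≠ x) → Function.Injective g →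
      ∀ (A : Matrix (Fin n) (Fin n) ℂ) (B : Matrix (Fin n) (Fin t) ℂ) (C : Matrix (Fin t) (Fin n) ℂ)
        (D : Matrix (Fin t) (Fin t) ℂ),
      (∀ z : σ → ℂ, (∀ j, ‖z j‖ ≤ 2) →
        MvPolynomial.eval z (1 + Matrix.diagonal (fun i => MvPolynomial.X (Sum.elim (fun _ => x) c i)) *
          (Matrix.fromBlocks A B C D).map (fun a : ℂ => (MvPolynomial.C a : MvPolynomial σ ℂ))).det ≠ 0) →
      ∃ (a : Polynomial ℂ) (p : {β : Fin f → Fin (t + 1) // β ≠ 0} → Polynomial ℂ),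
        a.coeff 0 = 1 ∧ a.natDegree ≤ n ∧ (∀ β, (p β).natDegree ≤ n + t) ∧
        (∀ m : ℕ, ‖a.coeff m‖ ≤ 3 * (((n : ℝ) + 1) / 2) ^ m) ∧
        (∀ (β : {β : Fin f → Fin (t + 1) // β ≠ 0}) (m : ℕ),
          ‖(p β).coeff m‖ ≤ 9 * ((t : ℝ) / 2) ^ (∑ j, (β.1 j : ℕ)) * (((n : ℝ) + 1) / 2) ^ m) ∧
        (1 + Matrix.diagonal (fun i => MvPolynomial.X (Sum.elim (fun _ => x) c i)) *
            (Matrix.fromBlocks A B C D).map (fun a : ℂ => (MvPolynomial.C a : MvPolynomial σ ℂ))).det =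
          Polynomial.aeval (MvPolynomial.X x : MvPolynomial σ ℂ) a +
            ∑ β : {β : Fin f → Fin (t + 1) // β ≠ 0},
              Polynomial.aeval (MvPolynomial.X x : MvPolynomial σ ℂ) (p β) *
                ∏ j : Fin f, (MvPolynomial.X (g j) : MvPolynomial σ ℂ) ^ (β.1 j : ℕ) := by
  intro σ x n t f c g idx hgc hgx hg A B C D hP
  classical
  set P : MvPolynomial σ ℂ :=
    (1 + Matrix.diagonal (fun i => MvPolynomial.X (Sum.elim (fun _ => x) c i)) *
      (Matrix.fromBlocks A B C D).map (fun a : ℂ => (MvPolynomial.C a : MvPolynomial σ ℂ))).det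
    with hPdef
  have hcx : ∀ i, c i ≠ x := fun i => hgc i ▸ hgx (idx i)
  /- (1) `a = det (1 + ξ A)` and the bordered determinants `E_S` -/
  set a : Polynomial ℂ := ((1 : Matrix (Fin n) (Fin n) (Polynomial ℂ)) +
    (Polynomial.X : Polynomial ℂ) • A.map (fun a : ℂ => Polynomial.C a)).det with ha
  have ha_eval : ∀ ξ : ℂ, a.eval ξ = (1 + ξ • A).det := schur_eval_det_one_add_X_smul A
  obtain ⟨E, hE⟩ : ∃ E : Finset (Fin t) → Polynomial ℂ, E = fun S : Finset (Fin t) =>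
    (Matrix.fromBlocks
      ((1 : Matrix (Fin n) (Fin n) (Polynomial ℂ)) +
        (Polynomial.X : Polynomial ℂ) • A.map (fun a : ℂ => Polynomial.C a))
      ((Polynomial.X : Polynomial ℂ) •
        (B.submatrix id (fun i : S => (i : Fin t))).map (fun a : ℂ => Polynomial.C a))
      ((C.submatrix (fun i : S => (i : Fin t)) id).map (fun a : ℂ => Polynomial.C a))
      ((D.submatrix (fun i : S => (i : Fin t)) (fun i : S => (i : Fin t))).map
        (fun a : ℂ => Polynomial.C a))).det := ⟨_, rfl⟩
  have hexp : P = ∑ S : Finset (Fin t),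
      Polynomial.aeval (MvPolynomial.X x : MvPolynomial σ ℂ) (E S) *
        ∏ i ∈ S, MvPolynomial.X (c i) := by
    rw [hE]
    exact piece3_schurExpansion x c A B C D
  have hE0 : E ∅ = a := by
    rw [hE]
    exact det_fromBlocks_of_isEmpty_right _ _ _ _
  have hdegE : ∀ S, (E S).natDegree ≤ n + t := by
    intro S
    rw [hE]
    refine (natDegree_bordPoly_le_card A B C D _).trans ?_
    rw [Fintype.card_coe]
    exact Nat.add_le_add_left (S.card_le_univ.trans (by simp)) n
  have hevalS : ∀ z : σ → ℂ, MvPolynomial.eval z P =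
      ∑ S : Finset (Fin t), (E S).eval (z x) * ∏ i ∈ S, z (c i) := by
    intro z
    rw [hexp, map_sum]
    simp only [map_mul, map_prod, schur_eval_aeval_X, MvPolynomial.eval_X]
  /- (3) `a(ξ) ≠ 0` on `|ξ| ≤ 2` -/
  have h0 : ∀ j : σ, ‖(0 : σ → ℂ) j‖ ≤ 2 := fun j => by simp
  have ha_ne : ∀ ξ : ℂ, ‖ξ‖ ≤ 2 → a.eval ξ ≠ 0 := by
    intro ξ hξ
    have hvan : ∀ S : Finset (Fin t), S ≠ ∅ →
        (E S).eval (Function.update (0 : σ → ℂ) x ξ x) *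
          ∏ i ∈ S, Function.update (0 : σ → ℂ) x ξ (c i) = 0 := by
      intro S hS
      obtain ⟨i, hi⟩ := Finset.nonempty_iff_ne_empty.mpr hS
      rw [Finset.prod_eq_zero hi (by rw [Function.update_of_ne (hcx i)]; rfl), mul_zero]
    have h := hP (Function.update 0 x ξ) (bnd_norm_update_le h0 x hξ)
    rw [hevalS, Fintype.sum_eq_single (∅ : Finset (Fin t)) hvan, Function.update_self,
      Finset.prod_empty, mul_one, hE0] at h
    exact h
  /- (4) `|a| ≤ 3` on the small disc, and Cauchy -/
  obtain ⟨d, hd⟩ := exists_det_one_add_smul_eq_prod A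
  have hd2 : ∀ i, ‖d i‖ ≤ 1 / 2 := by
    refine norm_le_half_of_prod_ne_zero d fun s hs => ?_
    rw [← hd, ← ha_eval]
    exact ha_ne s hs
  have hn1 : (0 : ℝ) < (n : ℝ) + 1 := by positivity
  have hρ : (0 : ℝ) < 2 / ((n : ℝ) + 1) := by positivity
  have hρ2 : 2 / ((n : ℝ) + 1) ≤ 2 := div_le_self zero_le_two (by simp)
  have ha3 : ∀ ξ : ℂ, ‖ξ‖ ≤ 2 / ((n : ℝ) + 1) → ‖a.eval ξ‖ ≤ 3 := by
    intro ξ hξ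
    rw [ha_eval, hd, norm_prod]
    have hfac : ∀ i, ‖1 + ξ * d i‖ ≤ 1 + 1 / ((n : ℝ) + 1) := by
      intro i
      refine (norm_add_le _ _).trans ?_
      rw [norm_one, norm_mul]
      have : ‖ξ‖ * ‖d i‖ ≤ 2 / ((n : ℝ) + 1) * (1 / 2) :=
        mul_le_mul hξ (hd2 i) (norm_nonneg _) (by positivity)
      have h' : 2 / ((n : ℝ) + 1) * (1 / 2) = 1 / ((n : ℝ) + 1) := by ring
      linarith
    calc ∏ i, ‖1 + ξ * d i‖ ≤ ∏ _i : Fin n, (1 + 1 / ((n : ℝ) + 1)) :=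
          Finset.prod_le_prod (fun i _ => norm_nonneg _) fun i _ => hfac i
      _ = (1 + 1 / ((n : ℝ) + 1)) ^ n := by simp
      _ ≤ (1 + 1 / ((n : ℝ) + 1)) ^ (n + 1) :=
          pow_le_pow_right₀ (by simp only [le_add_iff_nonneg_right]; positivity) (Nat.le_succ n)
      _ ≤ 3 := by
          have h := one_add_inv_pow_le_three (n + 1) (Nat.succ_pos n)
          push_cast at h
          exact h
  have ha_coeff : ∀ m : ℕ, ‖a.coeff m‖ ≤ 3 * (((n : ℝ) + 1) / 2) ^ m := by
    intro m
    have h := piece_c_cauchy a (2 / ((n : ℝ) + 1)) 3 hρ ha3 m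
    rwa [div_eq_mul_inv, ← inv_pow, inv_div] at h
  /- (2) colour content of a set of foreign rows -/
  obtain ⟨cnt, hcnt⟩ : ∃ cnt : Finset (Fin t) → Fin f → ℕ,
      cnt = fun S j => (S.filter fun i => idx i = j).card := ⟨_, rfl⟩
  have hcnt_lt : ∀ S j, cnt S j < t + 1 := fun S j => by
    rw [hcnt]
    exact Nat.lt_succ_of_le ((Finset.card_filter_le _ _).trans (S.card_le_univ.trans (by simp)))
  obtain ⟨cont, hcont⟩ : ∃ cont : Finset (Fin t) → Fin f → Fin (t + 1),
      ∀ S j, (cont S j : ℕ) = cnt S j := ⟨fun S j => ⟨cnt S j, hcnt_lt S j⟩, fun S j => rfl⟩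
  have hcont_iff : ∀ (S : Finset (Fin t)) (β : Fin f → Fin (t + 1)),
      cont S = β ↔ cnt S = fun j => (β j : ℕ) := by
    intro S β
    constructor
    · rintro rfl
      funext j
      exact (hcont S j).symm
    · intro h
      funext j
      apply Fin.ext
      rw [hcont, h]
  have hcnt_empty : cnt ∅ = fun _ => 0 := by
    rw [hcnt]
    funext j
    simp
  have hcont_empty : cont ∅ = 0 := by
    rw [hcont_iff, hcnt_empty]
    funext j
    simp
  have hcont_zero_iff : ∀ S, cont S = 0 ↔ S = ∅ := by
    intro S
    refine ⟨fun h => ?_, fun h => h ▸ hcont_empty⟩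
    by_contra hS
    obtain ⟨i, hi⟩ := Finset.nonempty_iff_ne_empty.mpr hS
    have h1 : 0 < cnt S (idx i) := by
      rw [hcnt]
      exact Finset.card_pos.mpr ⟨i, Finset.mem_filter.mpr ⟨hi, rfl⟩⟩
    have h2 : cnt S (idx i) = 0 := by
      rw [← hcont, h]
      simp
    omega
  have hmon : ∀ S : Finset (Fin t), ∏ i ∈ S, (MvPolynomial.X (c i) : MvPolynomial σ ℂ) =
      ∏ j, (MvPolynomial.X (g j) : MvPolynomial σ ℂ) ^ (cont S j : ℕ) := by
    intro S
    have h1 : ∏ i ∈ S, (MvPolynomial.X (c i) : MvPolynomial σ ℂ) =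
        ∏ i ∈ S, (MvPolynomial.X (g (idx i)) : MvPolynomial σ ℂ) :=
      Finset.prod_congr rfl fun i _ => by rw [hgc]
    rw [h1, prod_comp_eq_prod_pow_card_fiber idx S
      (fun j => (MvPolynomial.X (g j) : MvPolynomial σ ℂ))]
    refine Fintype.prod_congr _ _ fun j => ?_
    rw [hcont, hcnt]
  /- the content family `p_β = Σ_{cont S = β} E_S` -/
  obtain ⟨p, hp⟩ : ∃ p : {β : Fin f → Fin (t + 1) // β ≠ 0} → Polynomial ℂ,
      p = fun β => ∑ S ∈ Finset.univ.filter (fun S => cont S = β.1), E S := ⟨_, rfl⟩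
  have hdegp : ∀ β, (p β).natDegree ≤ n + t := by
    intro β
    rw [hp]
    exact Polynomial.natDegree_sum_le_of_forall_le _ _ fun S _ => hdegE S
  have hident : P = Polynomial.aeval (MvPolynomial.X x : MvPolynomial σ ℂ) a +
      ∑ β : {β : Fin f → Fin (t + 1) // β ≠ 0},
        Polynomial.aeval (MvPolynomial.X x : MvPolynomial σ ℂ) (p β) *
          ∏ j : Fin f, (MvPolynomial.X (g j) : MvPolynomial σ ℂ) ^ (β.1 j : ℕ) := by
    rw [hexp]
    simp_rw [hmon]
    rw [← Finset.sum_fiberwise Finset.univ cont,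
      Fintype.sum_eq_add_sum_subtype_ne _ (0 : Fin f → Fin (t + 1))]
    congr 1
    · rw [Finset.sum_filter, Fintype.sum_eq_single (∅ : Finset (Fin t)) fun S hS =>
        if_neg (mt (hcont_zero_iff S).mp hS)]
      simp [hcont_empty, hE0]
    · refine Fintype.sum_congr _ _ fun β => ?_
      simp only [hp]
      rw [map_sum, Finset.sum_mul]
      refine Finset.sum_congr rfl fun S hS => ?_
      rw [(Finset.mem_filter.mp hS).2]
  /- (5) the foreign slice polynomial and the coefficient bound -/
  have hp_eval : ∀ ξ : ℂ, ‖ξ‖ ≤ 2 → ∀ β : {β : Fin f → Fin (t + 1) // β ≠ 0},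
      ‖(p β).eval ξ‖ ≤ 3 * ((t : ℝ) / 2) ^ (∑ j, (β.1 j : ℕ)) * ‖a.eval ξ‖ := by
    intro ξ hξ β
    have haξ := ha_ne ξ hξ
    -- `1 ≤ t`, since `β ≠ 0`
    have ht : 1 ≤ t := by
      by_contra ht0
      apply β.2
      funext j
      have hj := (β.1 j).isLt
      apply Fin.ext
      simp only [Pi.zero_apply, Fin.val_zero]
      omega
    obtain ⟨q, hq⟩ : ∃ q : MvPolynomial (Fin f) ℂ, q = ∑ S : Finset (Fin t),
        MvPolynomial.C ((E S).eval ξ / a.eval ξ) * ∏ i ∈ S, MvPolynomial.X (idx i) := ⟨_, rfl⟩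
    have hq_eval : ∀ w : Fin f → ℂ, MvPolynomial.eval w q =
        ∑ S : Finset (Fin t), (E S).eval ξ / a.eval ξ * ∏ i ∈ S, w (idx i) := by
      intro w
      rw [hq, map_sum]
      simp only [map_mul, MvPolynomial.eval_C, map_prod, MvPolynomial.eval_X]
    have hq_deg : q.totalDegree ≤ t := by
      rw [hq]
      refine MvPolynomial.totalDegree_finsetSum_le fun S _ => ?_
      refine (MvPolynomial.totalDegree_mul _ _).trans ?_
      rw [MvPolynomial.totalDegree_C, zero_add]
      refine (MvPolynomial.totalDegree_finsetProd _ _).trans ?_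
      calc ∑ i ∈ S, (MvPolynomial.X (idx i) : MvPolynomial (Fin f) ℂ).totalDegree
          = S.card := by simp [MvPolynomial.totalDegree_X]
        _ ≤ t := S.card_le_univ.trans (by simp)
    have hq0 : MvPolynomial.eval (0 : Fin f → ℂ) q = 1 := by
      have hvan : ∀ S : Finset (Fin t), S ≠ ∅ →
          (E S).eval ξ / a.eval ξ * ∏ i ∈ S, (0 : Fin f → ℂ) (idx i) = 0 := by
        intro S hS
        obtain ⟨i, hi⟩ := Finset.nonempty_iff_ne_empty.mpr hS
        rw [Finset.prod_eq_zero hi rfl, mul_zero]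
      rw [hq_eval, Fintype.sum_eq_single (∅ : Finset (Fin t)) hvan, Finset.prod_empty, mul_one, hE0]
      exact div_self haξ
    have hqz : ∀ w : Fin f → ℂ, (∀ j, ‖w j‖ ≤ 2) → MvPolynomial.eval w q ≠ 0 := by
      intro w hw
      have hw' : ∀ e, ‖Function.extend g w 0 e‖ ≤ 2 := by
        intro e
        by_cases he : ∃ j, g j = e
        · obtain ⟨j, rfl⟩ := he
          rw [hg.extend_apply]
          exact hw j
        · rw [Function.extend_apply' _ _ _ he]
          simp
      have h := hP (Function.update (Function.extend g w 0) x ξ) (bnd_norm_update_le hw' x hξ)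
      rw [hevalS, Function.update_self] at h
      have hzc : ∀ i, Function.update (Function.extend g w 0) x ξ (c i) = w (idx i) := by
        intro i
        rw [Function.update_of_ne (hcx i), ← hgc i, hg.extend_apply]
      simp_rw [hzc] at h
      intro hq0'
      apply h
      calc ∑ S, (E S).eval ξ * ∏ i ∈ S, w (idx i)
          = a.eval ξ * MvPolynomial.eval w q := by
            rw [hq_eval, Finset.mul_sum]
            refine Finset.sum_congr rfl fun S _ => ?_
            rw [← mul_assoc, mul_div_assoc', mul_div_cancel_left₀ _ haξ]
        _ = 0 := by rw [hq0', mul_zero]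
    have hmono : ∀ S : Finset (Fin t), ∏ i ∈ S, (MvPolynomial.X (idx i) : MvPolynomial (Fin f) ℂ) =
        MvPolynomial.monomial (Finsupp.equivFunOnFinite.symm (cnt S)) 1 := by
      intro S
      rw [prod_comp_eq_prod_pow_card_fiber idx S MvPolynomial.X, MvPolynomial.monomial_eq,
        MvPolynomial.C_1, one_mul, Finsupp.prod_fintype _ _ fun j => pow_zero _]
      refine Fintype.prod_congr _ _ fun j => ?_
      rw [Finsupp.coe_equivFunOnFinite_symm, hcnt]
    have hcoeff : q.coeff (Finsupp.equivFunOnFinite.symm fun j => (β.1 j : ℕ)) =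
        (p β).eval ξ / a.eval ξ := by
      rw [hq, MvPolynomial.coeff_sum]
      simp_rw [hmono, MvPolynomial.coeff_C_mul, MvPolynomial.coeff_monomial, mul_ite, mul_one,
        mul_zero]
      rw [← Finset.sum_filter]
      simp only [hp, Polynomial.eval_finsetSum, Finset.sum_div]
      refine Finset.sum_congr ?_ fun S _ => rfl
      ext S
      simp only [Finset.mem_filter, Finset.mem_univ, true_and, hcont_iff]
      exact Finsupp.equivFunOnFinite.symm.apply_eq_iff_eq
    have hb := piece3_coeffBound q t ht hq_deg hq0 hqz
      (Finsupp.equivFunOnFinite.symm fun j => (β.1 j : ℕ))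
    rw [hcoeff, norm_div, div_le_iff₀ (norm_pos_iff.mpr haξ), Finsupp.degree_eq_sum] at hb
    simpa only [Finsupp.coe_equivFunOnFinite_symm] using hb
  /- (6) the coefficient bounds for `p_β` -/
  have hp_coeff : ∀ (β : {β : Fin f → Fin (t + 1) // β ≠ 0}) (m : ℕ),
      ‖(p β).coeff m‖ ≤ 9 * ((t : ℝ) / 2) ^ (∑ j, (β.1 j : ℕ)) * (((n : ℝ) + 1) / 2) ^ m := by
    intro β m
    have h9 : ∀ ξ : ℂ, ‖ξ‖ ≤ 2 / ((n : ℝ) + 1) →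
        ‖(p β).eval ξ‖ ≤ 9 * ((t : ℝ) / 2) ^ (∑ j, (β.1 j : ℕ)) := by
      intro ξ hξ
      have hK : (0 : ℝ) ≤ 3 * ((t : ℝ) / 2) ^ (∑ j, (β.1 j : ℕ)) := by positivity
      calc ‖(p β).eval ξ‖ ≤ 3 * ((t : ℝ) / 2) ^ (∑ j, (β.1 j : ℕ)) * ‖a.eval ξ‖ :=
            hp_eval ξ (hξ.trans hρ2) β
        _ ≤ 3 * ((t : ℝ) / 2) ^ (∑ j, (β.1 j : ℕ)) * 3 := mul_le_mul_of_nonneg_left (ha3 ξ hξ) hK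
        _ = 9 * ((t : ℝ) / 2) ^ (∑ j, (β.1 j : ℕ)) := by ring
    have h := piece_c_cauchy (p β) (2 / ((n : ℝ) + 1)) _ hρ h9 m
    rwa [div_eq_mul_inv, ← inv_pow, inv_div] at h
  refine ⟨a, p, ?_, ?_, hdegp, ha_coeff, hp_coeff, hident⟩
  · rw [Polynomial.coeff_zero_eq_eval_zero, ha_eval]
    simp
  · rw [← hE0, hE]
    exact (natDegree_bordPoly_le_card A B C D _).trans (by simp)

end Summit.ValiantsHypothesis.ValiantsHypothesis.Theorems.PriceOfContractivity.FewColours
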